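/-
Copyright (c) 2026 the pub-hodgecm-mathlib formalisation cell (harness21).  Prover seat hodgecm-mathlib-LH7-p07 (g0), Track A «(D-RAM) FOUR-FRAME» squad, helper lane on
h413 = stmt-HodgeConjecture-24833 (count-neutral).  β-BOARD v1 row R7 Theorem C (holder LH7-p05 (g0), ask 15:54:35Z «(r0)(r2) in split-sign form»).  2026-09-04.
-/
import Summits.HodgeConjecture.HodgeConjecture.Theorems.F0P3cDyRamGlueWindowVanishing   -- ★ p861670 (this seat): the three slot sums, product-inside form
import HarnessLib

/-!
# Crux `H413`, line LH4 «(D-RAM) FOUR-FRAME» — β-BOARD R7 «GLUE CLASSES», THEOREM C: THE SLOT SUMS IN SPLIT-SIGN FORM `Σ ω(r)·ω(r + c₀) = 0`, `Σ ω(1 + r)·ω(r + c₀) = 0`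
# (LH7-p05 (g0)'s `F₀`, `F₂` letters VERBATIM) over every complete irredundant system of the r-shell, and the corresponding WINDOW DOUBLE SUMS

Cell `hodgecm-mathlib` (D-0151), FLOOR 0, crux item H413 = `stmt-HodgeConjecture-24833`, route `HCCMUnconditional`; squad F0∕P3c∕LH4, β-BOARD v1 row R7.  THEOREMS ONLY (no `def`,
no instance, no notation, no `sorry`, default heartbeats); ★-only imports; lane `--supports stmt-HodgeConjecture-24833 --as helper`; pays NO row, states NO law.
A thin sequel of ★ p861670 (which is at the 400-line lint): `ω` is multiplicative on the non-zero fixed elements (★ toolkit `normSign_mul_of_fixed`), and on the shell `r`, `r + c₀`,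
`1 + r` are fixed and non-zero, so ★ p861670's product-inside heads give the split-sign ones termwise.
* §1 `sum_normSign_mul_normSign_add_shell_eq_zero` (`F₀`), `sum_normSign_one_add_mul_normSign_add_shell_eq_zero` (`F₂`) — over ANY system `Sh` of the shell.
* §2 `sum_filter_sum_normSign_mul_normSign_add_eq_zero`, `sum_filter_sum_normSign_one_add_mul_normSign_add_eq_zero` — the window double sums (★ (iv-c) ∕ ★ PT-3 letters).
HONEST LABEL.  Count-neutral; R7 Theorem C, the (β) table, (β-BAL), T₊ stay OPEN; `HC_CM` is proved only modulo the 7 printed citations (2 remaining named inputs: hLiu418 =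
`stmt-HodgeConjecture-24832`, h413 = `stmt-HodgeConjecture-24833`) until rung 0 closes.

## References
* [Serre1979] J.-P. Serre, *Local Fields*, GTM 67 (1979): Ch. V §3 Cor. 3, Ch. XV §2 (`ω` is a character of `F^× ∕ N(E^×)`).
-/

set_option autoImplicit false

noncomputable section

namespace Summit.HodgeConjecture.HodgeConjecture.Cruxes.H413.F0P3cDyRamGlueWindowVanishingSigns

open WithZero
open scoped Valued
open Literature.NumberTheory.Automorphic.UnitaryThreeFourFrame
open Literature.NumberTheory.LocalFields.WildQuadraticDatum
open Summit.HodgeConjecture.HodgeConjecture.Cruxes.H413.F0P3cDyRamGlueWindowVanishing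

variable {K : Type} [Field K] [Valued K ℤᵐ⁰] {σ : K →+* K} {ϖ : K} {d t : ℕ}

/-! ## §1  Split-sign slot sums over any system of the shell -/

section Shell

variable [CompleteSpace K] [Finite 𝓀[K]] [DecidableEq K]

omit [CompleteSpace K] [Finite 𝓀[K]] [DecidableEq K] in
/-- Shell letters: `r` in the shell (`σr = r`, `|r| = |ϖ|^s`, `|r + c₀| = |ϖ|^e`, `1 ≤ s`) has `r ≠ 0`, `r + c₀ ≠ 0`, `1 + r` a fixed unit. [cite: Serre1979, Ch. XV §2] -/
theorem shell_letters (hϖ : Valued.v ϖ = exp (-1 : ℤ)) {s e : ℕ} (hs : 1 ≤ s) {c₀ : K} (hσc₀ : σ c₀ = c₀)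
    {r : K} (hσr : σ r = r) (hvr : Valued.v r = Valued.v ϖ ^ s) (hre : Valued.v (r + c₀) = Valued.v ϖ ^ e) :
    r ≠ 0 ∧ r + c₀ ≠ 0 ∧ σ (r + c₀) = r + c₀ ∧ σ (1 + r) = 1 + r ∧ Valued.v (1 + r) = 1 ∧ 1 + r ≠ 0 := by
  have hvϖ0 : Valued.v ϖ ≠ 0 := by rw [hϖ]; exact exp_ne_zero
  have hϖ1 : Valued.v ϖ < 1 := by rw [hϖ, ← exp_zero]; exact exp_lt_exp.2 (by norm_num)
  have hr0 : r ≠ 0 := fun h0 => by rw [h0, map_zero] at hvr; exact pow_ne_zero _ hvϖ0 hvr.symm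
  have hrc0 : r + c₀ ≠ 0 := fun h0 => by rw [h0, map_zero] at hre; exact pow_ne_zero _ hvϖ0 hre.symm
  have h1r : Valued.v (1 + r) = 1 := Valued.v.map_one_add_of_lt (by rw [hvr]; exact pow_lt_one₀ zero_le hϖ1 (by omega))
  exact ⟨hr0, hrc0, by rw [map_add, hσr, hσc₀], by rw [map_add, map_one, hσr], h1r,
    fun h0 => by rw [h0, map_zero] at h1r; exact zero_ne_one h1r⟩

/-- **`F₀`: `Σ_{r ∈ Sh} ω(r)·ω(r + c₀) = 0`** over any complete irredundant system modulo `𝔭^N` of the shell (`2 ≤ d`, `1 ≤ s ≤ e`, `|c₀| = |ϖ|^s`, `e + 2d − 1 ≤ N`).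
[cite: Serre1979, Ch. V §3 Cor. 3; Ch. XV §2] -/
theorem sum_normSign_mul_normSign_add_shell_eq_zero (hD : IsRamifiedQuadraticDatum σ ϖ d t) (h2v : Valued.v (2 : K) < 1) (h2d : 2 ≤ d)
    {s e N : ℕ} (hs : 1 ≤ s) (hse : s ≤ e) (hN : e + (2 * d - 1) ≤ N) {c₀ : K} (hσc₀ : σ c₀ = c₀) (hc₀ : Valued.v c₀ = Valued.v ϖ ^ s)
    (Sh : Finset K) (hSh1 : ∀ r ∈ Sh, σ r = r ∧ Valued.v r = Valued.v ϖ ^ s ∧ Valued.v (r + c₀) = Valued.v ϖ ^ e)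
    (hSh2 : ∀ r : K, σ r = r → Valued.v r = Valued.v ϖ ^ s → Valued.v (r + c₀) = Valued.v ϖ ^ e → ∃ x ∈ Sh, Valued.v (r - x) ≤ Valued.v ϖ ^ N)
    (hSh3 : ∀ x ∈ Sh, ∀ x' ∈ Sh, Valued.v (x - x') ≤ Valued.v ϖ ^ N → x = x') :
    ∑ r ∈ Sh, normSign σ r * normSign σ (r + c₀) = 0 := by
  obtain ⟨-, -, hϖ, -, -, -, -⟩ := id hD
  rw [← sum_normSign_mul_add_shell_eq_zero hD h2v h2d hs hse hN hσc₀ hc₀ Sh hSh1 hSh2 hSh3]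
  refine Finset.sum_congr rfl fun r hr => ?_
  obtain ⟨hσr, hvr, hre⟩ := hSh1 r hr
  obtain ⟨hr0, hrc0, hσrc, -, -, -⟩ := shell_letters hϖ hs hσc₀ hσr hvr hre
  rw [normSign_mul_of_fixed hD hσr hσrc hr0 hrc0]

/-- **`F₂`: `Σ_{r ∈ Sh} ω(1 + r)·ω(r + c₀) = 0`** (same data). [cite: Serre1979, Ch. V §3 Cor. 3; Ch. XV §2] -/
theorem sum_normSign_one_add_mul_normSign_add_shell_eq_zero (hD : IsRamifiedQuadraticDatum σ ϖ d t) (h2v : Valued.v (2 : K) < 1) (h2d : 2 ≤ d)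
    {s e N : ℕ} (hs : 1 ≤ s) (hse : s ≤ e) (hN : e + (2 * d - 1) ≤ N) {c₀ : K} (hσc₀ : σ c₀ = c₀) (hc₀ : Valued.v c₀ = Valued.v ϖ ^ s)
    (Sh : Finset K) (hSh1 : ∀ r ∈ Sh, σ r = r ∧ Valued.v r = Valued.v ϖ ^ s ∧ Valued.v (r + c₀) = Valued.v ϖ ^ e)
    (hSh2 : ∀ r : K, σ r = r → Valued.v r = Valued.v ϖ ^ s → Valued.v (r + c₀) = Valued.v ϖ ^ e → ∃ x ∈ Sh, Valued.v (r - x) ≤ Valued.v ϖ ^ N)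
    (hSh3 : ∀ x ∈ Sh, ∀ x' ∈ Sh, Valued.v (x - x') ≤ Valued.v ϖ ^ N → x = x') :
    ∑ r ∈ Sh, normSign σ (1 + r) * normSign σ (r + c₀) = 0 := by
  obtain ⟨-, -, hϖ, -, -, -, -⟩ := id hD
  rw [← sum_normSign_one_add_mul_add_shell_eq_zero hD h2v h2d hs hse hN hσc₀ hc₀ Sh hSh1 hSh2 hSh3]
  refine Finset.sum_congr rfl fun r hr => ?_
  obtain ⟨hσr, hvr, hre⟩ := hSh1 r hr
  obtain ⟨-, hrc0, hσrc, hσ1r, -, h1r0⟩ := shell_letters hϖ hs hσc₀ hσr hvr hre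
  rw [normSign_mul_of_fixed hD hσ1r hσrc h1r0 hrc0]

end Shell

/-! ## §2  The window double sums in split-sign form -/

section Window

variable [CompleteSpace K] [Finite 𝓀[K]] [DecidableEq K]

/-- **WINDOW, `F₀`: `Σ_{g ∈ R.filter cut} Σ_{aβ ∈ Aβ} ω(r)·ω(r + c₀) = 0`, `r = g + (1+g)(aβ − 1)`** (window data of ★ p861670 §5). [cite: Serre1979, Ch. V §3 Cor. 3; Ch. XV §2] -/
theorem sum_filter_sum_normSign_mul_normSign_add_eq_zero (hD : IsRamifiedQuadraticDatum σ ϖ d t) (h2v : Valued.v (2 : K) < 1) (h2d : 2 ≤ d)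
    {s n k M e : ℕ} (hs : 1 ≤ s) (hsn : s < n) (hse : s ≤ e) (hen : e < n) (hnM : n ≤ 2 * M) (heM : e + (2 * d - 1) ≤ 2 * M)
    (hMk : 2 * M ≤ k + d) (hkM : k + d ≤ 2 * M + 1) (hdM : d ≤ M) (hMk2 : M ≤ k)
    {c₀ : K} (hσc₀ : σ c₀ = c₀) (hc₀ : Valued.v c₀ = Valued.v ϖ ^ s) (R : Finset K) (hR1 : ∀ g ∈ R, σ g = g ∧ Valued.v g = Valued.v ϖ ^ s)
    (hR2 : ∀ f : K, σ f = f → Valued.v f = Valued.v ϖ ^ s → ∃ g ∈ R, Valued.v (f - g) ≤ Valued.v ϖ ^ n)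
    (hR3 : ∀ g ∈ R, ∀ g' ∈ R, Valued.v (g - g') ≤ Valued.v ϖ ^ n → g = g')
    (Aβ : Finset K) (hAβsub : ∀ a ∈ Aβ, σ a = a ∧ Valued.v (a - 1) ≤ Valued.v ϖ ^ n)
    (hAβ : ∀ y : K, σ y = y → Valued.v (y - 1) ≤ Valued.v ϖ ^ n → ∃! a, a ∈ Aβ ∧ ∃ s : K, Valued.v (s - 1) ≤ Valued.v ϖ ^ k ∧ s * σ s = a / y) :
    ∑ g ∈ R.filter (fun g => Valued.v (g + c₀) = Valued.v ϖ ^ e), ∑ a ∈ Aβ,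
      normSign σ (g + (1 + g) * (a - 1)) * normSign σ ((g + (1 + g) * (a - 1)) + c₀) = 0 :=
  sum_filter_sum_eq_zero_of_shell hD hs hsn hen hnM hMk hkM hdM hMk2 R hR1 hR2 hR3 Aβ hAβsub hAβ (fun r => normSign σ r * normSign σ (r + c₀))
    (fun Sh h1 h2 h3 => sum_normSign_mul_normSign_add_shell_eq_zero hD h2v h2d hs hse heM hσc₀ hc₀ Sh h1 h2 h3)

/-- **WINDOW, `F₂`: `Σ_{g ∈ R.filter cut} Σ_{aβ ∈ Aβ} ω(1 + r)·ω(r + c₀) = 0`, `r = g + (1+g)(aβ − 1)`** (window data of ★ p861670 §5). [cite: Serre1979, Ch. V §3 Cor. 3; Ch. XV §2] -/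
theorem sum_filter_sum_normSign_one_add_mul_normSign_add_eq_zero (hD : IsRamifiedQuadraticDatum σ ϖ d t) (h2v : Valued.v (2 : K) < 1) (h2d : 2 ≤ d)
    {s n k M e : ℕ} (hs : 1 ≤ s) (hsn : s < n) (hse : s ≤ e) (hen : e < n) (hnM : n ≤ 2 * M) (heM : e + (2 * d - 1) ≤ 2 * M)
    (hMk : 2 * M ≤ k + d) (hkM : k + d ≤ 2 * M + 1) (hdM : d ≤ M) (hMk2 : M ≤ k)
    {c₀ : K} (hσc₀ : σ c₀ = c₀) (hc₀ : Valued.v c₀ = Valued.v ϖ ^ s) (R : Finset K) (hR1 : ∀ g ∈ R, σ g = g ∧ Valued.v g = Valued.v ϖ ^ s)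
    (hR2 : ∀ f : K, σ f = f → Valued.v f = Valued.v ϖ ^ s → ∃ g ∈ R, Valued.v (f - g) ≤ Valued.v ϖ ^ n)
    (hR3 : ∀ g ∈ R, ∀ g' ∈ R, Valued.v (g - g') ≤ Valued.v ϖ ^ n → g = g')
    (Aβ : Finset K) (hAβsub : ∀ a ∈ Aβ, σ a = a ∧ Valued.v (a - 1) ≤ Valued.v ϖ ^ n)
    (hAβ : ∀ y : K, σ y = y → Valued.v (y - 1) ≤ Valued.v ϖ ^ n → ∃! a, a ∈ Aβ ∧ ∃ s : K, Valued.v (s - 1) ≤ Valued.v ϖ ^ k ∧ s * σ s = a / y) :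
    ∑ g ∈ R.filter (fun g => Valued.v (g + c₀) = Valued.v ϖ ^ e), ∑ a ∈ Aβ,
      normSign σ (1 + (g + (1 + g) * (a - 1))) * normSign σ ((g + (1 + g) * (a - 1)) + c₀) = 0 :=
  sum_filter_sum_eq_zero_of_shell hD hs hsn hen hnM hMk hkM hdM hMk2 R hR1 hR2 hR3 Aβ hAβsub hAβ (fun r => normSign σ (1 + r) * normSign σ (r + c₀))
    (fun Sh h1 h2 h3 => sum_normSign_one_add_mul_normSign_add_shell_eq_zero hD h2v h2d hs hse heM hσc₀ hc₀ Sh h1 h2 h3)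

end Window

end Summit.HodgeConjecture.HodgeConjecture.Cruxes.H413.F0P3cDyRamGlueWindowVanishingSigns

end
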